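import Summits.Ventures.PercRepro.RankDistRestrictedVandermonde
import Summits.Ventures.PercRepro.RankDistUpSetGirth
import Summits.Ventures.PercRepro.RankDistCumulative
import Mathlib.Combinatorics.Matroid.Sum

/-!
# PercRepro — THE TIGHT LAYER OF A DIRECT SUM IS A PRODUCT: bottom sets, up-set and the shadow profile of
`M ⊕ N` are those of the factors, the profile being the CONVOLUTION (p9, gen 22)

`M ⊕ N = M.disjointSum N h` (Mathlib, disjoint ground sets). The rank is additive
(`eRk_disjointSum`, `rk_disjointSum`: `ρ(X) = ρ_M(X ∩ E_M) + ρ_N(X ∩ E_N)`), so is the rank of the whole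
(`eRank_disjointSum`) and the size of the ground set (`card_gr_disjointSum`). On tight layers (`|E_M| = p₁ + q₁`,
`ρ(M) = p₁`; `|E_N| = p₂ + q₂`, `ρ(N) = p₂`) the sum is on the tight layer `(p₁ + p₂, q₁ + q₂)` and a bottom set of
the sum is exactly a union of bottom sets of the factors (`mem_Uq_disjointSum`: the complement, a base of the sum,
is a base in each factor, which forces the sizes `q₁`, `q₂`); the up-set of the bottom sets is the product of the
up-sets, and the shadow level `u` of the sum is the disjoint union over `v` of the products of the shadow levels
`v` of `M` and `u − v` of `N` (`card_shadowLev_disjointSum`):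
**`s_u(M ⊕ N) = Σ_{v ≤ u} s_v(M) · s_{u−v}(N)`**. The shadow levels of a factor vanish below its `q`
(`card_shadowLev_eq_zero_of_lt`), so `s_{q₁+q₂}(M ⊕ N) = s_{q₁}(M) · s_{q₂}(N)`. `RankDistDirectSumSC` combines this
with the restricted Vandermonde inequality into the closure of the row (SC) under direct sums. Nothing here moves
any window of the crux.
-/

namespace PercRepro.RankDist

open Set Finset _root_.Matroid PercRepro.ThmH

variable {α : Type} [DecidableEq α]

/-! ## Rank additivity -/

omit [DecidableEq α] in
/-- **Rank additivity in a direct sum**: `ρ(X) = ρ_M(X ∩ E_M) + ρ_N(X ∩ E_N)` for `X ⊆ E_M ∪ E_N`. -/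
lemma eRk_disjointSum (M N : Matroid α) (h : Disjoint M.E N.E) {X : Set α} (hX : X ⊆ M.E ∪ N.E) :
    (M.disjointSum N h).eRk X = M.eRk (X ∩ M.E) + N.eRk (X ∩ N.E) := by
  obtain ⟨I, hI⟩ := M.exists_isBasis (X ∩ M.E) Set.inter_subset_right
  obtain ⟨J, hJ⟩ := N.exists_isBasis (X ∩ N.E) Set.inter_subset_right
  have hIM : I ⊆ M.E := hI.subset.trans Set.inter_subset_right
  have hJN : J ⊆ N.E := hJ.subset.trans Set.inter_subset_right
  have hdisj : Disjoint I J := h.mono hIM hJN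
  have hIJ : (M.disjointSum N h).IsBasis (I ∪ J) X := by
    rw [disjointSum_isBasis_iff]
    refine ⟨?_, ?_, Set.union_subset (hI.subset.trans Set.inter_subset_left)
      (hJ.subset.trans Set.inter_subset_left), hX⟩
    · rw [Set.union_inter_distrib_right, Set.inter_eq_self_of_subset_left hIM,
        Set.disjoint_iff_inter_eq_empty.1 (h.symm.mono_left hJN), Set.union_empty]
      exact hI
    · rw [Set.union_inter_distrib_right, Set.inter_eq_self_of_subset_left hJN,
        Set.disjoint_iff_inter_eq_empty.1 (h.mono_left hIM), Set.empty_union]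
      exact hJ
  rw [hIJ.eRk_eq_encard, hI.eRk_eq_encard, hJ.eRk_eq_encard, Set.encard_union_eq hdisj]

omit [DecidableEq α] in
/-- The rank of a direct sum is the sum of the ranks. -/
lemma eRank_disjointSum (M N : Matroid α) (h : Disjoint M.E N.E) :
    (M.disjointSum N h).eRank = M.eRank + N.eRank := by
  rw [eRank_def, disjointSum_ground_eq, eRk_disjointSum M N h (Set.Subset.refl _),
    Set.union_inter_cancel_left, Set.union_inter_cancel_right, ← eRank_def, ← eRank_def]

omit [DecidableEq α] in
/-- The natural rank is additive: `rk(X) = rk_M(X ∩ E_M) + rk_N(X ∩ E_N)` for `X ⊆ E_M ∪ E_N`. -/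
lemma rk_disjointSum (M N : Matroid α) [M.Finite] [N.Finite] (h : Disjoint M.E N.E)
    [hS : (M.disjointSum N h).Finite] {X : Set α} (hX : X ⊆ M.E ∪ N.E) :
    rk (M.disjointSum N h) X = rk M (X ∩ M.E) + rk N (X ∩ N.E) := by
  have hXS : X ⊆ (M.disjointSum N h).E := by rwa [disjointSum_ground_eq]
  have e := eRk_disjointSum M N h hX
  rw [eRk_eq_coe_rk _ hXS, eRk_eq_coe_rk M Set.inter_subset_right, eRk_eq_coe_rk N Set.inter_subset_right] at e
  exact_mod_cast e

omit [DecidableEq α] in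
/-- The ground finset of a direct sum has `|E_M| + |E_N|` elements. -/
lemma card_gr_disjointSum (M N : Matroid α) [M.Finite] [N.Finite] (h : Disjoint M.E N.E)
    [hS : (M.disjointSum N h).Finite] : (gr (M.disjointSum N h)).card = (gr M).card + (gr N).card := by
  rw [card_gr, card_gr, card_gr, disjointSum_ground_eq, Set.ncard_union_eq h M.ground_finite N.ground_finite]

/-- The ground finset of a direct sum is the union of the ground finsets. -/
lemma gr_disjointSum (M N : Matroid α) [M.Finite] [N.Finite] (h : Disjoint M.E N.E)
    [hS : (M.disjointSum N h).Finite] : gr (M.disjointSum N h) = gr M ∪ gr N := by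
  rw [← Finset.coe_inj, Finset.coe_union, coe_gr, coe_gr, coe_gr, disjointSum_ground_eq]

/-! ## The bottom sets of the tight layer of a direct sum -/

/-- **The bottom sets of a direct sum of tight layers** (`|E_M| = p₁ + q₁`, `ρ(M) = p₁`, `|E_N| = p₂ + q₂`,
`ρ(N) = p₂`): `B` is a bottom set of `(p₁ + p₂, q₁ + q₂)` in `M ⊕ N` iff `B ⊆ E_M ∪ E_N` and its two parts are
bottom sets of the factors. -/
theorem mem_Uq_disjointSum (M N : Matroid α) [M.Finite] [N.Finite] (h : Disjoint M.E N.E)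
    [hS : (M.disjointSum N h).Finite] {p₁ q₁ p₂ q₂ : ℕ} (hn₁ : (gr M).card = p₁ + q₁)
    (hr₁ : M.eRank = (p₁ : ℕ∞)) (hn₂ : (gr N).card = p₂ + q₂) (hr₂ : N.eRank = (p₂ : ℕ∞)) {B : Finset α} :
    B ∈ PerFlat.Uq (M.disjointSum N h) (p₁ + p₂) (q₁ + q₂) ↔
      B ⊆ gr M ∪ gr N ∧ B ∩ gr M ∈ PerFlat.Uq M p₁ q₁ ∧ B ∩ gr N ∈ PerFlat.Uq N p₂ q₂ := by
  have hn : (gr (M.disjointSum N h)).card = p₁ + p₂ + (q₁ + q₂) := by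
    rw [card_gr_disjointSum, hn₁, hn₂]
    ring
  have hr : (M.disjointSum N h).eRank = ((p₁ + p₂ : ℕ) : ℕ∞) := by
    rw [eRank_disjointSum, hr₁, hr₂]
    norm_cast
  have hgrM : (gr M : Set α) = M.E := coe_gr M
  have hgrN : (gr N : Set α) = N.E := coe_gr N
  have hgrdisj : Disjoint (gr M) (gr N) := by
    rw [← Finset.disjoint_coe, hgrM, hgrN]
    exact h
  rw [mem_Uq_tight _ hn hr, mem_Uq_tight M hn₁ hr₁, mem_Uq_tight N hn₂ hr₂, gr_disjointSum]
  -- the set-level identities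
  have hcoeM : ((B ∩ gr M : Finset α) : Set α) = (B : Set α) ∩ M.E := by rw [Finset.coe_inter, hgrM]
  have hcoeN : ((B ∩ gr N : Finset α) : Set α) = (B : Set α) ∩ N.E := by rw [Finset.coe_inter, hgrN]
  have hcM : (((gr M ∪ gr N) \ B : Finset α) : Set α) ∩ M.E = ((gr M \ (B ∩ gr M) : Finset α) : Set α) := by
    rw [Finset.coe_sdiff, Finset.coe_union, Finset.coe_sdiff, Finset.coe_inter, hgrM, hgrN]
    ext x
    simp only [Set.mem_inter_iff, Set.mem_sdiff, Set.mem_union, Finset.mem_coe]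
    constructor
    · rintro ⟨⟨-, hxB⟩, hxM⟩
      exact ⟨hxM, fun hx => hxB hx.1⟩
    · rintro ⟨hxM, hx⟩
      exact ⟨⟨Or.inl hxM, fun hxB => hx ⟨hxB, hxM⟩⟩, hxM⟩
  have hcN : (((gr M ∪ gr N) \ B : Finset α) : Set α) ∩ N.E = ((gr N \ (B ∩ gr N) : Finset α) : Set α) := by
    rw [Finset.coe_sdiff, Finset.coe_union, Finset.coe_sdiff, Finset.coe_inter, hgrM, hgrN]
    ext x
    simp only [Set.mem_inter_iff, Set.mem_sdiff, Set.mem_union, Finset.mem_coe]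
    constructor
    · rintro ⟨⟨-, hxB⟩, hxN⟩
      exact ⟨hxN, fun hx => hxB hx.1⟩
    · rintro ⟨hxN, hx⟩
      exact ⟨⟨Or.inr hxN, fun hxB => hx ⟨hxB, hxN⟩⟩, hxN⟩
  constructor
  · rintro ⟨hBE, hBind, hBcard, hBbase⟩
    rw [disjointSum_indep_iff] at hBind
    rw [disjointSum_isBase_iff] at hBbase
    obtain ⟨hindM, hindN, -⟩ := hBind
    obtain ⟨hbaseM, hbaseN, -⟩ := hBbase
    rw [hcM] at hbaseM
    rw [hcN] at hbaseN
    rw [← hcoeM] at hindM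
    rw [← hcoeN] at hindN
    -- the sizes are forced by the bases of the complements
    have hMcard : (gr M \ (B ∩ gr M)).card = p₁ := by
      have e := hbaseM.encard_eq_eRank
      rw [hr₁, Set.encard_coe_eq_coe_finsetCard] at e
      exact_mod_cast e
    have hNcard : (gr N \ (B ∩ gr N)).card = p₂ := by
      have e := hbaseN.encard_eq_eRank
      rw [hr₂, Set.encard_coe_eq_coe_finsetCard] at e
      exact_mod_cast e
    have h1 := Finset.card_sdiff_add_card_inter (gr M) (B ∩ gr M)
    have h2 := Finset.card_sdiff_add_card_inter (gr N) (B ∩ gr N)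
    rw [Finset.inter_eq_right.2 Finset.inter_subset_right] at h1 h2
    refine ⟨hBE, ⟨Finset.inter_subset_right, hindM, by omega, hbaseM⟩,
      ⟨Finset.inter_subset_right, hindN, by omega, hbaseN⟩⟩
  · rintro ⟨hBE, ⟨-, hindM, hMcard, hbaseM⟩, ⟨-, hindN, hNcard, hbaseN⟩⟩
    have hBE' : (B : Set α) ⊆ M.E ∪ N.E := by
      rw [← hgrM, ← hgrN, ← Finset.coe_union]
      exact Finset.coe_subset.2 hBE
    refine ⟨hBE, ?_, ?_, ?_⟩
    · rw [disjointSum_indep_iff, ← hcoeM, ← hcoeN]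
      exact ⟨hindM, hindN, hBE'⟩
    · have hsplit : (B ∩ gr M).card + (B ∩ gr N).card = B.card := by
        rw [← Finset.card_union_of_disjoint (hgrdisj.mono Finset.inter_subset_right Finset.inter_subset_right),
          ← Finset.inter_union_distrib_left, Finset.inter_eq_left.2 hBE]
      omega
    · rw [disjointSum_isBase_iff, hcM, hcN]
      refine ⟨hbaseM, hbaseN, ?_⟩
      rw [Finset.coe_sdiff, Finset.coe_union, hgrM, hgrN]
      exact Set.sdiff_subset

/-! ## The up-set and the shadow levels of a direct sum -/

/-- **A set contains a bottom set of the sum iff its parts contain bottom sets of the factors.** -/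
lemma exists_mem_Uq_subset_disjointSum_iff (M N : Matroid α) [M.Finite] [N.Finite] (h : Disjoint M.E N.E)
    [hS : (M.disjointSum N h).Finite] {p₁ q₁ p₂ q₂ : ℕ} (hn₁ : (gr M).card = p₁ + q₁)
    (hr₁ : M.eRank = (p₁ : ℕ∞)) (hn₂ : (gr N).card = p₂ + q₂) (hr₂ : N.eRank = (p₂ : ℕ∞)) {A : Set α} :
    (∃ B ∈ PerFlat.Uq (M.disjointSum N h) (p₁ + p₂) (q₁ + q₂), (B : Set α) ⊆ A) ↔
      (∃ B₁ ∈ PerFlat.Uq M p₁ q₁, (B₁ : Set α) ⊆ A ∩ M.E) ∧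
        (∃ B₂ ∈ PerFlat.Uq N p₂ q₂, (B₂ : Set α) ⊆ A ∩ N.E) := by
  have hgrM : (gr M : Set α) = M.E := coe_gr M
  have hgrN : (gr N : Set α) = N.E := coe_gr N
  have hgrdisj : Disjoint (gr M) (gr N) := by
    rw [← Finset.disjoint_coe, hgrM, hgrN]
    exact h
  constructor
  · rintro ⟨B, hB, hBA⟩
    obtain ⟨-, hBM, hBN⟩ := (mem_Uq_disjointSum M N h hn₁ hr₁ hn₂ hr₂).1 hB
    refine ⟨⟨B ∩ gr M, hBM, ?_⟩, ⟨B ∩ gr N, hBN, ?_⟩⟩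
    · rw [Finset.coe_inter, hgrM]
      exact Set.inter_subset_inter_left _ hBA
    · rw [Finset.coe_inter, hgrN]
      exact Set.inter_subset_inter_left _ hBA
  · rintro ⟨⟨B₁, hB₁, hB₁A⟩, ⟨B₂, hB₂, hB₂A⟩⟩
    have hB₁M : B₁ ⊆ gr M := (PerFlat.mem_Uq.1 hB₁).1
    have hB₂N : B₂ ⊆ gr N := (PerFlat.mem_Uq.1 hB₂).1
    refine ⟨B₁ ∪ B₂, ?_, ?_⟩
    · rw [mem_Uq_disjointSum M N h hn₁ hr₁ hn₂ hr₂]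
      refine ⟨Finset.union_subset_union hB₁M hB₂N, ?_, ?_⟩
      · rw [Finset.union_inter_distrib_right, Finset.inter_eq_left.2 hB₁M,
          Finset.disjoint_iff_inter_eq_empty.1 (hgrdisj.symm.mono_left hB₂N), Finset.union_empty]
        exact hB₁
      · rw [Finset.union_inter_distrib_right, Finset.inter_eq_left.2 hB₂N,
          Finset.disjoint_iff_inter_eq_empty.1 (hgrdisj.mono_left hB₁M), Finset.empty_union]
        exact hB₂
    · rw [Finset.coe_union]
      exact Set.union_subset (hB₁A.trans Set.inter_subset_left) (hB₂A.trans Set.inter_subset_left)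

/-- The shadow levels of a tight layer vanish below `q`: a member contains a bottom set, of rank `q`. -/
lemma card_shadowLev_eq_zero_of_lt (M : Matroid α) [M.Finite] {p q v : ℕ} (hv : v < q) :
    (shadowLev M v (PerFlat.Uq M p q)).card = 0 := by
  rw [Finset.card_eq_zero, Finset.eq_empty_iff_forall_notMem]
  intro A hA
  obtain ⟨hAE, hrk, B, hB, hBA⟩ := (mem_shadowLev M).1 hA
  have hBq : rk M (B : Set α) = q := by
    rw [rk_eq_iff M (hBA.trans hAE)]
    exact (PerFlat.mem_Uq.1 hB).2.1
  have := rk_mono_of_subset M hBA hAE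
  omega

/-- **THE SHADOW PROFILE OF A DIRECT SUM IS THE CONVOLUTION**: on tight layers,
`s_u(M ⊕ N) = Σ_{v ≤ u} s_v(M) · s_{u−v}(N)`. -/
theorem card_shadowLev_disjointSum (M N : Matroid α) [M.Finite] [N.Finite] (h : Disjoint M.E N.E)
    [hS : (M.disjointSum N h).Finite] {p₁ q₁ p₂ q₂ : ℕ} (hn₁ : (gr M).card = p₁ + q₁)
    (hr₁ : M.eRank = (p₁ : ℕ∞)) (hn₂ : (gr N).card = p₂ + q₂) (hr₂ : N.eRank = (p₂ : ℕ∞)) (u : ℕ) :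
    (shadowLev (M.disjointSum N h) u (PerFlat.Uq (M.disjointSum N h) (p₁ + p₂) (q₁ + q₂))).card
      = ∑ v ∈ Finset.range (u + 1),
          (shadowLev M v (PerFlat.Uq M p₁ q₁)).card * (shadowLev N (u - v) (PerFlat.Uq N p₂ q₂)).card := by
  classical
  have hE : (M.disjointSum N h).E = M.E ∪ N.E := disjointSum_ground_eq
  rw [Finset.card_eq_sum_card_fiberwise (f := fun A => rk M (A ∩ M.E)) (t := Finset.range (u + 1))]
  · refine Finset.sum_congr rfl fun v hv => ?_
    rw [Finset.mem_range] at hv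
    rw [← Finset.card_product]
    refine Finset.card_bij' (fun A _ => (A ∩ M.E, A ∩ N.E)) (fun P _ => P.1 ∪ P.2) ?_ ?_ ?_ ?_
    · intro A hA
      rw [Finset.mem_filter, mem_shadowLev] at hA
      obtain ⟨⟨hAE, hrk, hbot⟩, hv'⟩ := hA
      rw [hE] at hAE
      rw [rk_disjointSum M N h hAE] at hrk
      obtain ⟨hb₁, hb₂⟩ := (exists_mem_Uq_subset_disjointSum_iff M N h hn₁ hr₁ hn₂ hr₂).1 hbot
      rw [Finset.mem_product, mem_shadowLev, mem_shadowLev]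
      dsimp only
      exact ⟨⟨Set.inter_subset_right, hv', hb₁⟩, ⟨Set.inter_subset_right, by omega, hb₂⟩⟩
    · rintro ⟨A₁, A₂⟩ hP
      rw [Finset.mem_product, mem_shadowLev, mem_shadowLev] at hP
      dsimp only at hP
      obtain ⟨⟨hA₁E, hrk₁, hb₁⟩, ⟨hA₂E, hrk₂, hb₂⟩⟩ := hP
      have hA : A₁ ∪ A₂ ⊆ M.E ∪ N.E := Set.union_subset_union hA₁E hA₂E
      have e1 : (A₁ ∪ A₂) ∩ M.E = A₁ := by
        rw [Set.union_inter_distrib_right, Set.inter_eq_self_of_subset_left hA₁E,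
          Set.disjoint_iff_inter_eq_empty.1 (h.symm.mono_left hA₂E), Set.union_empty]
      have e2 : (A₁ ∪ A₂) ∩ N.E = A₂ := by
        rw [Set.union_inter_distrib_right, Set.inter_eq_self_of_subset_left hA₂E,
          Set.disjoint_iff_inter_eq_empty.1 (h.mono_left hA₁E), Set.empty_union]
      rw [Finset.mem_filter, mem_shadowLev]
      dsimp only
      refine ⟨⟨by rw [hE]; exact hA, ?_, ?_⟩, by rw [e1]; exact hrk₁⟩
      · rw [rk_disjointSum M N h hA, e1, e2, hrk₁, hrk₂]
        omega
      · rw [exists_mem_Uq_subset_disjointSum_iff M N h hn₁ hr₁ hn₂ hr₂, e1, e2]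
        exact ⟨hb₁, hb₂⟩
    · intro A hA
      rw [Finset.mem_filter, mem_shadowLev] at hA
      dsimp only
      rw [← Set.inter_union_distrib_left, Set.inter_eq_self_of_subset_left (by rw [← hE]; exact hA.1.1)]
    · rintro ⟨A₁, A₂⟩ hP
      rw [Finset.mem_product, mem_shadowLev, mem_shadowLev] at hP
      dsimp only at hP ⊢
      obtain ⟨⟨hA₁E, -, -⟩, ⟨hA₂E, -, -⟩⟩ := hP
      have e1 : (A₁ ∪ A₂) ∩ M.E = A₁ := by
        rw [Set.union_inter_distrib_right, Set.inter_eq_self_of_subset_left hA₁E,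
          Set.disjoint_iff_inter_eq_empty.1 (h.symm.mono_left hA₂E), Set.union_empty]
      have e2 : (A₁ ∪ A₂) ∩ N.E = A₂ := by
        rw [Set.union_inter_distrib_right, Set.inter_eq_self_of_subset_left hA₂E,
          Set.disjoint_iff_inter_eq_empty.1 (h.mono_left hA₁E), Set.empty_union]
      rw [e1, e2]
  · intro A hA
    rw [Finset.mem_coe, mem_shadowLev] at hA
    obtain ⟨hAE, hrk, -⟩ := hA
    rw [hE] at hAE
    rw [rk_disjointSum M N h hAE] at hrk
    rw [Finset.mem_coe, Finset.mem_range]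
    show rk M (A ∩ M.E) < u + 1
    omega

/-- **The bottom level of a direct sum**: `s_{q₁+q₂}(M ⊕ N) = s_{q₁}(M) · s_{q₂}(N)` (all other terms of the
convolution vanish). -/
theorem card_shadowLev_disjointSum_bot (M N : Matroid α) [M.Finite] [N.Finite] (h : Disjoint M.E N.E)
    [hS : (M.disjointSum N h).Finite] {p₁ q₁ p₂ q₂ : ℕ} (hn₁ : (gr M).card = p₁ + q₁)
    (hr₁ : M.eRank = (p₁ : ℕ∞)) (hn₂ : (gr N).card = p₂ + q₂) (hr₂ : N.eRank = (p₂ : ℕ∞)) :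
    (shadowLev (M.disjointSum N h) (q₁ + q₂) (PerFlat.Uq (M.disjointSum N h) (p₁ + p₂) (q₁ + q₂))).card
      = (shadowLev M q₁ (PerFlat.Uq M p₁ q₁)).card * (shadowLev N q₂ (PerFlat.Uq N p₂ q₂)).card := by
  rw [card_shadowLev_disjointSum M N h hn₁ hr₁ hn₂ hr₂]
  rw [Finset.sum_eq_single q₁]
  · rw [Nat.add_sub_cancel_left]
  · intro v hv hne
    rw [Finset.mem_range] at hv
    rcases Nat.lt_or_gt_of_ne hne with hlt | hgt
    · rw [card_shadowLev_eq_zero_of_lt M hlt, Nat.zero_mul]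
    · rw [card_shadowLev_eq_zero_of_lt N (by omega), Nat.mul_zero]
  · intro hq
    rw [Finset.mem_range] at hq
    omega

end PercRepro.RankDist
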